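import Summits.CriticalPhenomena.CardyFormulaZ2.Theorems.CardyIKTransportIKMixedBoxCrossingSplit

/-!
# Line `defect-closure-exploration`, reshape v7 (lead c7) = merger with the strategist's ALT line `quenched-chain-fkg`:
# VOCABULARY + COMPOSITION for the crux `IKMixedBoxCrossing` (stmt-CriticalPhenomena-5911)

Definitions-only support file (`--supports stmt-CriticalPhenomena-5911`), same device as `…DefectDefs.lean` (p97097),
`…TransportDefs.lean` (p128988): every `def … : Prop` below is a statement the LINE POSITS (a registered stub or glue), never a
literature fact; the compositions are sorry-free.  After the typed split (`…IKMixedBoxCrossingSplit.lean`, p143979) the crux is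
kernel-equivalent to its HORIZONTAL clause `Split.HorizontalClause`; this file decomposes that clause.

THE LEVER (strategist seat `cstrat-stmt-CriticalPhenomena-5911-s2`, card `Cruxes/IKMixedBoxCrossing/Lines/quenched-chain-fkg.md`).
By the landed defect representation (c3 L1, `stub_colourLawMixture` p125999) the box law of the column-mixed IK colour field is the
uniform measure on the linear code `{σ : σ even on every face of D}` averaged over an i.i.d. Bernoulli(ρ) set `D` of defect faces on
the `S`-columns (`ρ = 7 − 4√3`); and the uniform measure on any finite set `V ∋ 0, 𝟙` of colourings of a defect cluster is the uniform
mixture over the patterns `v ∈ V ∖ {0,𝟙}` of the three-point CHAIN measures `(δ_0 + (|V|−2) δ_v + δ_𝟙)/|V|` (`chain_decomposition`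
below, proved), each supported on the totally ordered set `0 ≤ v ≤ 𝟙`, hence positively associated.  So for EVERY pattern `S` the
annealed law is an exact mixture `P_S = ∫ P_ξ dπ_S(ξ)` over a COLOURLESS environment `ξ` (defects, coins, one pattern per defect
cluster) of measures satisfying Harris–FKG for black-increasing events, and
`P_S(∩ A_i) ≥ E_ξ ∏ P_ξ(A_i) ≥ ∏ P_S(A_i) − (k−1) max sd_ξ P_ξ(A_i)`: Harris holds up to the environment-variance of QUENCHED crossing
probabilities (numerically `≍ n^{-1/2}`, card §4).  Positive association is therefore AVAILABLE (quenched) for every gluing step; what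
is left is (a) a concentration statement (`ApproxHarrisFam`, mechanism-free consequence form) and (b) an ANISOTROPY floor.

THE RESHAPE (lead c7, memo `Lines/defect-closure-exploration-c7.md` §4 + this cycle): with approximate Harris for boundedly many
macroscopic box events, the anisotropy input can be taken in its WEAKEST form `TallEasyTransverse` (S4: an `n`-wide, `K₀ n`-tall box
is crossed the short way with probability `≥ δ₀`, some `K₀`), because the LADDER of overlapping easy crossings glued by the LANDED
all-aspect vertical clause (`verticalClause_aspect`, p146877) produces crossings of boxes at least as wide as tall (`SquaresFromTall`,
provable now), and the strategist's symmetry-free seven-event glue then gives the `2n × n` box (`RSWAssembly`, provable now).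
So `Split.HorizontalClause ⇐ TallEasyTransverse ∧ ApproxHarrisFam` modulo two provable assemblies and one provable specialisation
(`Harris7OfFam`).  `IsotropyFloorAll` (the strategist's anisotropy stub) implies `TallEasyTransverse` (`tallEasy_of_isotropyFloorAll`).

DISPROOF USED (`Cruxes/IKMixedBoxCrossing/Disproof.lean` v5, landed `Theorems/IKMixedBoxCrossing/Negative/*`):
`iKMixedBoxCrossing_false_without_n_pos` (`1 ≤ n` kept in every floor; `pLR S a b n 0 = 0` makes `K₀ = 0` impossible in
`TallEasyTransverse`); `c_le_quarter` (constants existential); `colourField_not_positivelyAssociated` (association is claimed only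
for the quenched measures `P_ξ`, never for `P_S`; annealing one face's pattern reproduces the refuter's `Cov = −ρ/16`).  No `def`
below restates a landed Negative lemma.
-/

noncomputable section

namespace Summit.CriticalPhenomena.CardyFormulaZ2.Cruxes.IKMixedBoxCrossing.QuenchedChainFKG

open scoped Classical BigOperators
open MeasureTheory
open Summit.CriticalPhenomena.CardyFormulaZ2.Theorems.IKLinearTransport.PinnedDiagramExchange
  (Ω μIK obs lrCross tbCross)
open Summit.CriticalPhenomena.CardyFormulaZ2.Cruxes.IKMixedBoxCrossing.PairedMirrorExploration (pLR pTB)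

/-! ## §1 The anisotropy layer: two forms -/

/-- **ISOTROPY FLOOR, every pattern** (strategist's form of the anisotropy layer): squares are crossed TRANSVERSALLY with
probability bounded below uniformly in the pattern, the scale and the position.  By the exact duality `pLR + pTB = 1` on squares
it can only fail through unbounded effective anisotropy; numerically `pLR ≥ 0.499` on every tested pattern (memo c7 §2), the sharp
value `½` being false for mixed patterns.  A statement the line POSITS (registered stub of the ALT line), not asserted here. -/
def IsotropyFloorAll : Prop :=
  ∃ δ : ℝ, 0 < δ ∧ ∀ S : Set ℤ, ∀ n : ℕ, 1 ≤ n → ∀ a b : ℤ, δ ≤ pLR S a b n n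

/-- **TALL EASY TRANSVERSE** (S4; the WEAKEST anisotropy input, memo c7 §4 / census S4): there are `K₀` and `δ > 0` such that every
`n`-wide, `K₀ n`-tall box is crossed LEFT-TO-RIGHT (the short way across the typed columns) with probability `≥ δ`, uniformly in the
pattern and the position.  Equivalent to "hard parallel crossings of `n × K₀ n` strips are not almost sure"; it is the confinement
input of the link calculus and the natural output of a Grimmett–Manolescu-type transverse transport (memo c6 §2 (ii)).
A statement the line POSITS (registered stub), not asserted here. -/
def TallEasyTransverse : Prop :=
  ∃ K₀ : ℕ, ∃ δ : ℝ, 0 < δ ∧ ∀ S : Set ℤ, ∀ n : ℕ, ∀ a b : ℤ, 1 ≤ n → δ ≤ pLR S a b n (K₀ * n)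

/-- The isotropy floor implies the tall-easy form (take `K₀ = 1`). -/
theorem tallEasy_of_isotropyFloorAll (h : IsotropyFloorAll) : TallEasyTransverse := by
  obtain ⟨δ, hδ, h⟩ := h
  exact ⟨1, δ, hδ, fun S n a b hn => by simpa only [one_mul] using h S n hn a b⟩

/-! ## §2 Box-event families and approximate Harris -/

/-- Specification of one box-crossing event: kind (`lr = true`: left–right, else bottom–top), corner `(a, b)`, width, height. -/
structure BoxSpec where
  /-- `true` for a left–right crossing, `false` for a bottom–top crossing. -/
  lr : Bool
  /-- Left column of the box. -/
  a : ℤ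
  /-- Bottom row of the box. -/
  b : ℤ
  /-- Width (number of cell columns). -/
  w : ℕ
  /-- Height (number of cell rows). -/
  h : ℕ

/-- The gauge event of a box specification under the pattern `S`. -/
def boxEvent (S : Set ℤ) (bs : BoxSpec) : Set Ω :=
  obs S ⁻¹' (if bs.lr then lrCross bs.a bs.b bs.w bs.h else tbCross bs.a bs.b bs.w bs.h)

/-- Its annealed probability (`= pLR` or `pTB`). -/
def boxProb (S : Set ℤ) (bs : BoxSpec) : ℝ := μIK.real (boxEvent S bs)

/-- `boxProb` of a left–right specification is `pLR`. -/
theorem boxProb_lr (S : Set ℤ) (a b : ℤ) (w h : ℕ) : boxProb S ⟨true, a, b, w, h⟩ = pLR S a b w h := rfl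

/-- `boxProb` of a bottom–top specification is `pTB`. -/
theorem boxProb_tb (S : Set ℤ) (a b : ℤ) (w h : ℕ) : boxProb S ⟨false, a, b, w, h⟩ = pTB S a b w h := rfl

/-- **APPROXIMATE HARRIS FOR FAMILIES OF MACROSCOPIC BOX EVENTS** (the quenched-concentration layer, mechanism-free consequence
form): for every number `k` of events and every `η > 0` there is a scale `n₀` beyond which ANY `k` box-crossing events whose boxes
are at least `n × n` (`n ≥ n₀`; positions, aspect ratios and kinds arbitrary) are positively correlated up to `η`, UNIFORMLY in the
pattern.  Route: exact Harris–FKG conditionally on the colourless environment gives `μ(∩) ≥ E_ξ ∏ P_ξ`, and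
`E_ξ ∏ P_ξ ≥ ∏ P_S − (k−1) max sd_ξ`, so the statement follows from `sup_{S, boxes ≥ n} Var_ξ P_ξ(box event) → 0` (two-replica
co-pivotality; numerically `≍ n^{-1/2}`, card §4).  A statement the line POSITS (registered stub), not asserted here. -/
def ApproxHarrisFam : Prop :=
  ∀ (k : ℕ) (η : ℝ), 0 < η → ∃ n₀ : ℕ, ∀ (S : Set ℤ) (n : ℕ), n₀ ≤ n → ∀ bs : Fin k → BoxSpec,
    (∀ i, n ≤ (bs i).w ∧ n ≤ (bs i).h) → (∏ i, boxProb S (bs i)) - η ≤ μIK.real (⋂ i, boxEvent S (bs i))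

/-! ## §3 The strategist's symmetry-free seven-event glue (verbatim from `Lines/quenched_chain_fkg.lean`) -/

/-- The shift of the symmetry-free glue: `s = ⌈n/3⌉` (so `1 ≤ s`, `2s ≤ n` and `n ≤ 4s` for `2 ≤ n`). -/
def glueShift (n : ℕ) : ℕ := (n + 2) / 3

/-- The SEVEN black-increasing box events of the symmetry-free glue inside the `2n × n` box at `(a,b)`, `s = glueShift n`: LR
crossings of the four `n × n` squares at column offsets `0, s, 2s, n` and BT crossings of the three overlap strips (widths `n − s`,
`n − s`, `2s`), all of height `n`.  Their intersection contains a black LR crossing of the `2n × n` box (planar gluing, part of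
`RSWAssembly`). -/
def glueEvent (S : Set ℤ) (n : ℕ) (a b : ℤ) : Set Ω :=
  obs S ⁻¹' (lrCross a b n n ∩ lrCross (a + glueShift n) b n n ∩ lrCross (a + 2 * glueShift n) b n n ∩ lrCross (a + n) b n n ∩
    tbCross (a + glueShift n) b (n - glueShift n) n ∩ tbCross (a + 2 * glueShift n) b (n - glueShift n) n ∩
    tbCross (a + n) b (2 * glueShift n) n)

/-- Product of the seven annealed probabilities of the glue events. -/
def glueProduct (S : Set ℤ) (n : ℕ) (a b : ℤ) : ℝ :=
  pLR S a b n n * pLR S (a + glueShift n) b n n * pLR S (a + 2 * glueShift n) b n n * pLR S (a + n) b n n *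
    pTB S (a + glueShift n) b (n - glueShift n) n * pTB S (a + 2 * glueShift n) b (n - glueShift n) n *
    pTB S (a + n) b (2 * glueShift n) n

/-- **APPROXIMATE HARRIS FOR THE GLUE** (strategist's form of the concentration layer): the seven glue events are positively
correlated up to a deficit that vanishes as `n → ∞`, uniformly in the pattern and the position.  Implied by `ApproxHarrisFam`
(`Harris7OfFam`, provable: the seven boxes at scale `n` are at least `⌈n/3⌉ × ⌈n/3⌉`).  A statement the line POSITS, not asserted. -/
def ApproxHarris7 : Prop :=
  ∀ η : ℝ, 0 < η → ∃ n₀ : ℕ, ∀ S : Set ℤ, ∀ n : ℕ, n₀ ≤ n → ∀ a b : ℤ,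
    glueProduct S n a b - η ≤ μIK.real (glueEvent S n a b)

/-! ## §4 The three provable pieces and the compositions -/

/-- **RSW ASSEMBLY** (strategist's STUB 3, provable now; no symmetry, no association of the annealed field): from the isotropy
floor (`δ`), the LANDED vertical clause at every aspect (`verticalClause_aspect`: the three overlap strips have height ≤ twice their
width), approximate Harris at `η = δ⁴ c_V³ / 2`, planar gluing of the seven events into an LR crossing of the `2n × n` box, and the
all-black bottom row (probability `4^{-n}` for every `S`) at the finitely many scales `n < max n₀ 2`.
A statement the line POSITS (registered stub), not asserted here. -/
def RSWAssembly : Prop :=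
  IsotropyFloorAll → ApproxHarris7 → Split.HorizontalClause

/-- **SQUARES FROM TALL-EASY** (lead c7, provable now — the LADDER): from `TallEasyTransverse` (`K₀, δ₀`), the landed all-aspect
vertical clause (BT crossings of `⌈n/2⌉ × K₀ n` boxes, aspect `2K₀`, probability `≥ c_V`) and approximate Harris for the
`4K₀ + 1` events of the ladder `LR[a+js, a+js+n) × [b, b+K₀n)` (`s = ⌊n/2⌋`, `j ≤ 2K₀`) and `BT` of their consecutive overlaps: an LR
crossing of box `j` ends on the right column of the overlap strip `O_j = [a+js+s, a+js+n)` and so contains an LR crossing of `O_j`,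
the LR crossing of box `j+1` starts on the left column of `O_j` inside box `j+1 ⊇ O_j`'s columns and so also contains one, and both
meet any BT crossing of `O_j` (plane graph: one diagonal per face); hence a black LR crossing of the `(K₀ n + n) × K₀ n` box, at
least as wide as tall, with probability `≥ (δ₀ c_V)^{2K₀+1}/2` for `n ≥ n₀`; squares of every side then by `Monotone'` (landed
p90765: `pLR` antitone in the width, `pTB` antitone in the height — here only width is used after trimming) and the all-black
bottom row at the finitely many small sides.  A statement the line POSITS (registered stub), not asserted here. -/
def SquaresFromTall : Prop :=
  TallEasyTransverse → ApproxHarrisFam → IsotropyFloorAll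

/-- **THE SEVEN-EVENT GLUE IS A FAMILY** (provable now, S-sized bookkeeping): `ApproxHarrisFam` at `k = 7` and scale
`glueShift n = ⌈n/3⌉` (every glue box is at least `⌈n/3⌉` wide and `n` tall) gives `ApproxHarris7`
(`glueProduct`/`glueEvent` are the product/intersection over the corresponding `Fin 7 → BoxSpec`).
A statement the line POSITS (registered stub), not asserted here. -/
def Harris7OfFam : Prop :=
  ApproxHarrisFam → ApproxHarris7

/-- **COMPOSITION (v7, kernel-checked, sorry-free): the horizontal clause from the five stub statements.** -/
theorem horizontalClause_of_quenchedStubs (hT : TallEasyTransverse) (hF : ApproxHarrisFam) (hSq : SquaresFromTall)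
    (h7 : Harris7OfFam) (hA : RSWAssembly) : Split.HorizontalClause :=
  hA (hSq hT hF) (h7 hF)

/-- The crux decl of the payload route (CardyIKTransport) from the five stub statements. -/
theorem IKMixedBoxCrossing_of_quenchedStubs (hT : TallEasyTransverse) (hF : ApproxHarrisFam) (hSq : SquaresFromTall)
    (h7 : Harris7OfFam) (hA : RSWAssembly) :
    Summit.CriticalPhenomena.CardyFormulaZ2.Theses.CardyIKTransport.IKMixedBoxCrossing :=
  Split.IKMixedBoxCrossing_of_horizontal (horizontalClause_of_quenchedStubs hT hF hSq h7 hA)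

/-- The same for the home-route copy of the decl (CardyDiluteOrbit). -/
theorem IKMixedBoxCrossing_of_quenchedStubs_diluteOrbit (hT : TallEasyTransverse) (hF : ApproxHarrisFam)
    (hSq : SquaresFromTall) (h7 : Harris7OfFam) (hA : RSWAssembly) :
    Summit.CriticalPhenomena.CardyFormulaZ2.Theses.CardyDiluteOrbit.IKMixedBoxCrossing :=
  Split.IKMixedBoxCrossing_of_horizontal_diluteOrbit (horizontalClause_of_quenchedStubs hT hF hSq h7 hA)

/-- The strategist's three-stub composition (ALT line `quenched-chain-fkg`), kept: isotropy + approximate Harris for the glue +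
assembly give the crux. -/
theorem IKMixedBoxCrossing_of_altStubs (hIso : IsotropyFloorAll) (hAH : ApproxHarris7) (hAsm : RSWAssembly) :
    Summit.CriticalPhenomena.CardyFormulaZ2.Theses.CardyIKTransport.IKMixedBoxCrossing :=
  Split.IKMixedBoxCrossing_of_horizontal (hAsm hIso hAH)

/-! ## §5 Registered stubs (name-keyed aliases) and the registered composition -/

namespace Registered

/-- Alias keyed by the registered stub name (OPEN: anisotropy, weakest form). -/
abbrev stub_tallEasyTransverse : Prop := TallEasyTransverse
/-- Alias keyed by the registered stub name (OPEN: quenched concentration, family form). -/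
abbrev stub_approxHarrisFam : Prop := ApproxHarrisFam
/-- Alias keyed by the registered stub name (provable: the ladder). -/
abbrev stub_squaresFromTall : Prop := SquaresFromTall
/-- Alias keyed by the registered stub name (provable: specialisation to the seven glue boxes). -/
abbrev stub_harris7OfFam : Prop := Harris7OfFam
/-- Alias keyed by the registered stub name (provable: the strategist's assembly). -/
abbrev stub_rswAssembly : Prop := RSWAssembly
/-- Alias keyed by the registered stub name of the ALT line (OPEN: anisotropy, square form). -/
abbrev stub_isotropyFloorAll : Prop := IsotropyFloorAll
/-- Alias keyed by the registered stub name of the ALT line (OPEN: concentration, glue form). -/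
abbrev stub_approxHarris7 : Prop := ApproxHarris7

end Registered

/-- **The horizontal clause — hence the crux — from the registered v7 stubs** (registered composition). -/
theorem horizontalClause_of_registered :
    Registered.stub_tallEasyTransverse → Registered.stub_approxHarrisFam → Registered.stub_squaresFromTall →
      Registered.stub_harris7OfFam → Registered.stub_rswAssembly → Split.HorizontalClause :=
  fun hT hF hSq h7 hA => horizontalClause_of_quenchedStubs hT hF hSq h7 hA

/-! ## §6 Elementary facts (sorry-free): glue geometry, and the chain decomposition behind the lever -/

/-- `1 ≤ ⌈n/3⌉` for `1 ≤ n`. -/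
theorem one_le_glueShift {n : ℕ} (hn : 1 ≤ n) : 1 ≤ glueShift n := by
  unfold glueShift; omega

/-- `2⌈n/3⌉ ≤ n` for `2 ≤ n`. -/
theorem two_mul_glueShift_le {n : ℕ} (hn : 2 ≤ n) : 2 * glueShift n ≤ n := by
  unfold glueShift; omega

/-- `n ≤ 4⌈n/3⌉`. -/
theorem le_four_mul_glueShift (n : ℕ) : n ≤ 4 * glueShift n := by
  unfold glueShift; omega

/-- `n ≤ 3⌈n/3⌉`: every glue box is at least `⌈n/3⌉` wide. -/
theorem le_three_mul_glueShift (n : ℕ) : n ≤ 3 * glueShift n := by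
  unfold glueShift; omega

/-- The overlap strips are at most twice as tall as wide, so the landed all-aspect vertical clause bounds their BT crossings. -/
theorem overlap_aspect {n : ℕ} (hn : 2 ≤ n) : n ≤ 2 * (n - glueShift n) ∧ n ≤ 2 * (2 * glueShift n) := by
  unfold glueShift; omega

/-- THE CHAIN DECOMPOSITION (strategist s2; finite, exact): on any finite set `V` of colourings containing the all-white and the
all-black colouring and at least one more element, the uniform average of `g` equals the uniform average over the patterns
`v ∈ V ∖ {⊥, ⊤}` of the three-point chain averages `(g ⊥ + (|V|−2) g v + g ⊤)/|V|`.  Each chain `⊥ ≤ v ≤ ⊤` carries a positively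
associated measure; this identity is what makes the defect environment colourless. -/
theorem chain_decomposition {α : Type*} [DecidableEq α] (V : Finset α) (bot top : α) (hb : bot ∈ V) (ht : top ∈ V)
    (hbt : bot ≠ top) (hV : 2 < V.card) (g : α → ℝ) :
    (∑ x ∈ V, g x) / V.card =
      (∑ v ∈ (V.erase bot).erase top, (g bot + (V.card - 2 : ℝ) * g v + g top) / V.card) / ((V.card : ℝ) - 2) := by
  have hcard : (((V.erase bot).erase top).card : ℝ) = V.card - 2 := by
    have h1 : top ∈ V.erase bot := Finset.mem_erase.mpr ⟨hbt.symm, ht⟩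
    rw [Finset.card_erase_of_mem h1, Finset.card_erase_of_mem hb]
    have : 2 ≤ V.card := by omega
    push_cast [Nat.sub_sub, this]
    ring
  have hsum : ∑ x ∈ V, g x = g bot + g top + ∑ v ∈ (V.erase bot).erase top, g v := by
    have h1 : top ∈ V.erase bot := Finset.mem_erase.mpr ⟨hbt.symm, ht⟩
    rw [← Finset.add_sum_erase V g hb, ← Finset.add_sum_erase _ g h1]
    ring
  rw [hsum]
  have key : ∑ v ∈ (V.erase bot).erase top, (g bot + ((V.card : ℝ) - 2) * g v + g top) / V.card
      = (((V.erase bot).erase top).card : ℝ) * ((g bot + g top) / V.card)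
        + (((V.card : ℝ) - 2) / V.card) * ∑ v ∈ (V.erase bot).erase top, g v := by
    have hterm : ∀ v, (g bot + ((V.card : ℝ) - 2) * g v + g top) / V.card
        = (g bot + g top) / V.card + (((V.card : ℝ) - 2) / V.card) * g v := fun v => by ring
    simp_rw [hterm]
    rw [Finset.sum_add_distrib, Finset.sum_const, nsmul_eq_mul, ← Finset.mul_sum]
  rw [key, hcard]
  have hV' : (V.card : ℝ) - 2 ≠ 0 := by
    have : (2 : ℝ) < V.card := by exact_mod_cast hV
    linarith
  have hVne : (V.card : ℝ) ≠ 0 := by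
    have : (2 : ℝ) < V.card := by exact_mod_cast hV
    linarith
  field_simp

end Summit.CriticalPhenomena.CardyFormulaZ2.Cruxes.IKMixedBoxCrossing.QuenchedChainFKG

end
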